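import Literature.RepresentationTheory.HeisenbergGroup.SchrodingerConjugateTorusSpherical
import Literature.NumberTheory.GelbartRogawski1991.FiniteAdelicSplittingAssembly
import Literature.NumberTheory.GelbartRogawski1991.RationalSymplecticUnramifiedVector
import Literature.NumberTheory.Automorphic.UnitaryGroupFinAdelicCenterLocal
import HarnessLib

/-!
# The spherical vectors of the local Weil representation of `U(J)` at a split place: assembly (Leaf C)

Topic `NumberTheory/GelbartRogawski1991`; namespace
`Literature.NumberTheory.GelbartRogawski1991.UnitaryDualPair.LocalSplitting.FinLocalSplittings`.  KERNEL ONLY: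
theorems, 0 definitions, 0 records, 0 named facts, 0 sorry.

For a restricted family `𝓢 : FinLocalSplittings …` of local splittings `s_v : U(J)(F_v) →* S̃p_{ψ_v}(𝕎_v)` over the
embeddings `ι_v` ([GelbartRogawski1991, §3.1 Prop. 3.1.1]) and its local Weil representations `ω_v = toRep ∘ s_v` on
`𝒮(F_vᴺ)`, this file assembles the statement

  (SPH)  the `U(J)(𝒪_v)`-fixed vectors of `ω_v` lie in the span of a linearly independent family `b : ℤ → 𝒮(F_vᴺ)` with
         `b 0 = 1_{𝒪_vᴺ}` and `ω_v(z₀ · 1_N) (b j) = b (j+1)`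

— the hypothesis `hsph` of `Liu2021/Def411WeilCarriersSurvivalSplit.exists_finset_mk_unitVec_ne_zero_of_sph` — from two
inputs:

* (A) `HeisenbergGroup/SchrodingerConjugateTorusSpherical` (mc-theta-3): for `γ ∈ Sp(𝕎_v)` preserving the self-dual
  lattice and ANY implementer `M` of the Darboux-conjugate torus element `γ⁻¹ m(ϖ·1) γ`, the `M^j 1_{𝒪ᴺ}` are linearly
  independent and span the vectors fixed by the `1_{𝒪ᴺ}`-normalised implementers of `γ⁻¹ m(GL_N(𝒪)) γ`;
* (B) split-place DARBOUX DATA (constructed in `GelbartRogawski1991/LocalUnitarySplitPlaceDarboux`, mc-theta-3; it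
  enters THIS file only as hypotheses of the stated shape, so that nothing here depends on that construction): at a
  place `v` of `F` split in `E`, an integral `γ ∈ Sp(𝕎_v)` and a coordinate `t` with `ι_v(z · 1_N) = γ⁻¹ m(t(z) · 1) γ`,
  `|t(z₀)| = q_v^{∓1}` for generators `z₀` of `U(J₁)(F_v)/U(J₁)(𝒪_v)`, and `γ⁻¹ m(GL_N(𝒪_v)) γ ⊆ ι_v(U(J)(𝒪_v))`.

§1 is the per-place CORE: given `γ`, `t`, `a₀ = t·1`, `z₁` with `ι_v(z₁·1_N) = γ⁻¹ m(a₀) γ` (`|t| = q⁻¹`) and the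
surjectivity `γ⁻¹ m(GL_N(𝒪)) γ ⊆ ι_v(U(J)(𝒪_v))`, the four clauses of (SPH) hold at `v` for `z₁`, with
`b j := ω_v(z₁·1_N)^j 1_{𝒪ᴺ}` (the implementer `M = s_v(z₁·1_N)` is genuine because `s_v` is a homomorphism over
`ι_v`; the normalised implementers of the compact part are the `s_v(κ)`, `κ ∈ U(J)(𝒪_v)`, by the unramified clause).
§2 flips the orientation (`z₁ ↦ z₁⁻¹`, `j ↦ -j`); §3 is the cofiniteness bookkeeping (`2`, `T⁻¹`, inverse coordinates);
§4 `eventually_forall_exists_shift_basis_of_darboux` is the `∀ᶠ v` assembly ⊢ `hsph` from Darboux data of the stated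
shape.  Deliberately NOT here: the instantiation at `splitDarboux` / `splitCoord` of `LocalUnitarySplitPlaceDarboux`
(a short sequel once that file is in the tree).

## References
* S. Gelbart, J. Rogawski, Invent. Math. 105 (1991), §3.1 (3.1.3) p. 456, §3.2 [GelbartRogawski1991].
* C. Mœglin, M.-F. Vignéras, J.-L. Waldspurger, LNM 1291 (1987), Chap. 2 II.1, II.10, III.1 [MoeglinVignerasWaldspurger1987].
* Y. Liu, Camb. J. Math. 9 (2021) = arXiv:2102.11518, proof of Lem. D.1 (l. 5241–5245) [Liu2021].
-/

set_option autoImplicit false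

noncomputable section

open scoped Matrix NNReal ValuativeRel
open NumberField IsDedekindDomain Filter Set MeasureTheory
open Literature.NumberTheory.Automorphic Literature.NumberTheory.Automorphic.UnitaryGroup
open Literature.RepresentationTheory.HeisenbergGroup
open Literature.NumberTheory.GaloisRepresentations.IsNonarchimedeanLocalField

namespace Literature.NumberTheory.GelbartRogawski1991.UnitaryDualPair.LocalSplitting.FinLocalSplittings

variable {F : Type} [Field F] [NumberField F] {E : Type} [Field E] [NumberField E] [Algebra F E]
  [Algebra.IsQuadraticExtension F E] {c : E ≃ₐ[F] E} {N : ℕ} {δ : E} {hcδ : c δ = -δ} {hδ : δ ≠ 0} {d : F}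
  {hd : δ * δ = algebraMap F E d} {T : Matrix (Fin N) (Fin N) F} {hT : T.IsSymm}
  {J : Matrix (Fin N) (Fin N) E} {hJ : J = T.map (algebraMap F E)}
  (𝓢 : FinLocalSplittings F E c N hcδ hδ hd T hT hJ) (J₁ : Matrix (Fin 1) (Fin 1) E) (hJ₁ : J₁ 0 0 ≠ 0)
  (hTd : IsUnit T.det) (v : HeightOneSpectrum (𝓞 F))

/-! ## §1 The per-place core: (SPH) from a Darboux conjugation of `ι_v` into the Siegel Levi -/

/-- `s_v(g)` implements `ι_v(g)` on the local Schrödinger model (the operator component of the pair `s_v(g)`).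
[cite: MoeglinVignerasWaldspurger1987, Chap. 2 II.1 (A)] -/
theorem implements_snd_s (g : localPi E c N J v) :
    Implements (localSchrodinger F N T v) (ofSymplectic _ (iota F E c N hcδ hδ hd T hT hJ v g))
      ((𝓢.s v g : LocalMp F N T v) : LocalSp F N T v ×
        (SchwartzBruhat (Fin N → v.adicCompletion F) ≃ₗ[ℂ] SchwartzBruhat (Fin N → v.adicCompletion F))).2 := by
  have h := (mem_MpPsi (localSchrodinger F N T v) _).1 (𝓢.s v g).2
  rwa [𝓢.fst_s v g] at h

/-- `ω_v(g) Φ = (s_v g).2 Φ`. [cite: MoeglinVignerasWaldspurger1987, Chap. 2 II.1] -/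
theorem omegaLoc_eq_snd_apply (g : localPi E c N J v) (Φ : SchwartzBruhat (Fin N → v.adicCompletion F)) :
    𝓢.omegaLoc v g Φ = ((𝓢.s v g : LocalMp F N T v) : LocalSp F N T v ×
        (SchwartzBruhat (Fin N → v.adicCompletion F) ≃ₗ[ℂ] SchwartzBruhat (Fin N → v.adicCompletion F))).2 Φ :=
  𝓢.omegaLoc_apply v g Φ

include hTd in
/-- **(SPH) at a place from a Darboux conjugation, orientation `|t| = q_v⁻¹`.**  Let `γ ∈ Sp(𝕎_v)` preserve the box
`𝒪_vᴺ × 𝒪_vᴺ`, let `a₀ = t · 1` with `|t|_v = q_v⁻¹`, and let `z₁ ∈ U(J₁)(F_v)` with `ι_v(z₁ · 1_N) = γ⁻¹ m(a₀) γ`;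
assume every `γ⁻¹ m(a) γ`, `a ∈ GL_N(𝒪_v)`, is some `ι_v κ`, `κ ∈ U(J)(𝒪_v)`, that `U(J)(𝒪_v)` fixes `1_{𝒪_vᴺ}` under
`ω_v`, and the local unramifiedness data (`ψ_v` of conductor `𝒪_v`, `2 ∈ 𝒪_v^×`, `T^{±1}` `v`-integral, `N ≥ 1`).  Then
`b j := ω_v(z₁ · 1_N)^j 1_{𝒪_vᴺ}` satisfies the four clauses of (SPH) at `v` for `z₁`.
[cite: GelbartRogawski1991, §3.1 (3.1.3) p. 456, §3.2; MoeglinVignerasWaldspurger1987, Chap. 2 II.10, III.1] -/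
theorem exists_shift_basis_of_iota_localCenter_eq [NeZero N]
    (hcond : (adeleAddCharAt F v).HasConductorExp 0)
    (h2 : (⅟(2 : v.adicCompletion F) : v.adicCompletion F) ∈ v.adicCompletionIntegers F)
    (hTi : ∀ i j, localGram F N T v i j ∈ primePowBall (v.adicCompletion F) 0)
    (hTi' : ∀ i j, (localGram F N T v)⁻¹ i j ∈ primePowBall (v.adicCompletion F) 0)
    (hunr : ∀ κ ∈ localInt E c N J v, 𝓢.omegaLoc v κ (unitVec F (Fin N) v) = unitVec F (Fin N) v)
    (γ : LocalSp F N T v)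
    (hγ : ∀ p ∈ (piPrimePowBall (v.adicCompletion F) (Fin N) 0) ×ˢ (piPrimePowBall (v.adicCompletion F) (Fin N) 0),
      (γ : ((Fin N → v.adicCompletion F) × (Fin N → v.adicCompletion F)) ≃ₗ[v.adicCompletion F]
        ((Fin N → v.adicCompletion F) × (Fin N → v.adicCompletion F))) p ∈
        (piPrimePowBall (v.adicCompletion F) (Fin N) 0) ×ˢ (piPrimePowBall (v.adicCompletion F) (Fin N) 0))
    {t : v.adicCompletion F} (ht : normAbs (v.adicCompletion F) t = (residueFieldCard (v.adicCompletion F) : ℝ≥0)⁻¹)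
    {a₀ : GL (Fin N) (v.adicCompletion F)} (ha₀ : (a₀ : Matrix (Fin N) (Fin N) (v.adicCompletion F)) = t • 1)
    (z₁ : localPi E c 1 J₁ v)
    (hcenter : iota F E c N hcδ hδ hd T hT hJ v (localCenter E c N J J₁ hJ₁ v z₁) =
      γ⁻¹ * SymplecticMatrix.transportSp (localGram F N T v) (isUnit_det_localGram F N T hTd v)
        (SymplecticMatrix.levi a₀) * γ)
    (hcompact : ∀ a : GL (Fin N) 𝒪[v.adicCompletion F], ∃ κ ∈ localInt E c N J v,
      iota F E c N hcδ hδ hd T hT hJ v κ =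
        γ⁻¹ * SymplecticMatrix.transportSp (localGram F N T v) (isUnit_det_localGram F N T hTd v)
          (SymplecticMatrix.levi (Matrix.GeneralLinearGroup.map (𝒪[v.adicCompletion F]).subtype a)) * γ) :
    ∃ b : ℤ → SchwartzBruhat (Fin N → v.adicCompletion F), b 0 = unitVec F (Fin N) v ∧ LinearIndependent ℂ b ∧
      (∀ j : ℤ, 𝓢.omegaLoc v (localCenter E c N J J₁ hJ₁ v z₁) (b j) = b (j + 1)) ∧
      (∀ u : SchwartzBruhat (Fin N → v.adicCompletion F),
        (∀ κ ∈ localInt E c N J v, 𝓢.omegaLoc v κ u = u) → u ∈ Submodule.span ℂ (Set.range b)) := by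
  haveI : Nonempty (Fin N) := ⟨⟨0, Nat.pos_of_ne_zero (NeZero.ne N)⟩⟩
  letI : MeasurableSpace (v.adicCompletion F) := borel _
  haveI : BorelSpace (v.adicCompletion F) := ⟨rfl⟩
  have hbT : ∀ y : Fin N → v.adicCompletion F, Continuous fun u : Fin N → v.adicCompletion F =>
      localPairing F N T v u y := fun y => by
    simp only [Matrix.toLinearMap₂'_apply', dotProduct]
    exact continuous_finsetSum _ fun i _ => (continuous_apply i).mul continuous_const
  -- the implementer `M = s_v(z₁ · 1_N)` of the conjugate torus element
  set M : SchwartzBruhat (Fin N → v.adicCompletion F) ≃ₗ[ℂ] SchwartzBruhat (Fin N → v.adicCompletion F) :=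
    ((𝓢.s v (localCenter E c N J J₁ hJ₁ v z₁) : LocalMp F N T v) : LocalSp F N T v ×
      (SchwartzBruhat (Fin N → v.adicCompletion F) ≃ₗ[ℂ] SchwartzBruhat (Fin N → v.adicCompletion F))).2 with hM_def
  have hM : Implements (localSchrodinger F N T v) (ofSymplectic _
      (γ⁻¹ * SymplecticMatrix.transportSp (localGram F N T v) (isUnit_det_localGram F N T hTd v)
        (SymplecticMatrix.levi a₀) * γ)) M := by
    rw [← hcenter]; exact 𝓢.implements_snd_s v _
  refine ⟨fun j => (M ^ j) (unitVec F (Fin N) v), ?_, ?_, fun j => ?_, fun u hu => ?_⟩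
  · -- `b 0 = 1_{𝒪ᴺ}`
    simp only [zpow_zero, LinearEquiv.coe_one, id_eq]
  · -- linear independence (Leaf A)
    exact linearIndependent_zpow_apply_integersIndicator_of_mapsTo (localGram F N T v)
      (isUnit_det_localGram F N T hTd v) (isLocallyConstant_of_isContinuousNontrivial
        (isContinuousNontrivial_adeleAddCharAt F v)) hbT (unitVec F (Fin N) v)
      (coe_unitVec_eq_indicator_piPrimePowBall F N v) Measure.addHaar (isContinuousNontrivial_adeleAddCharAt F v)
      hcond ((mem_primePowBall_zero_iff _).2 h2) hTi hTi' γ hγ ht ha₀ hM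
  · -- the shift: `ω_v(z₁·1_N) (M^j Φ₀) = M^{j+1} Φ₀`
    show 𝓢.omegaLoc v (localCenter E c N J J₁ hJ₁ v z₁) ((M ^ j) (unitVec F (Fin N) v)) =
      (M ^ (j + 1)) (unitVec F (Fin N) v)
    rw [𝓢.omegaLoc_eq_snd_apply v, ← hM_def, show j + 1 = 1 + j from add_comm j 1, zpow_one_add,
      LinearEquiv.mul_apply]
  · -- the fixed vectors (Leaf A)
    refine mem_span_zpow_apply_integersIndicator_of_mapsTo (localGram F N T v) (isUnit_det_localGram F N T hTd v)
      (isLocallyConstant_of_isContinuousNontrivial (isContinuousNontrivial_adeleAddCharAt F v)) hbT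
      (unitVec F (Fin N) v) (coe_unitVec_eq_indicator_piPrimePowBall F N v) Measure.addHaar
      (isContinuousNontrivial_adeleAddCharAt F v) hcond ((mem_primePowBall_zero_iff _).2 h2) hTi hTi' γ hγ ht ha₀ hM
      u fun a => ?_
    obtain ⟨κ, hκ, hκa⟩ := hcompact a
    refine ⟨((𝓢.s v κ : LocalMp F N T v) : LocalSp F N T v ×
      (SchwartzBruhat (Fin N → v.adicCompletion F) ≃ₗ[ℂ] SchwartzBruhat (Fin N → v.adicCompletion F))).2,
      ?_, ?_, ?_⟩
    · rw [← hκa]; exact 𝓢.implements_snd_s v κ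
    · rw [← 𝓢.omegaLoc_eq_snd_apply v]; exact hunr κ hκ
    · rw [← 𝓢.omegaLoc_eq_snd_apply v]; exact hu κ hκ

/-! ## §2 Flipping the orientation -/

/-- **orientation flip**: spherical data for `z⁻¹` give spherical data for `z` (reindex `j ↦ -j`).
[cite: GelbartRogawski1991, §3.2] -/
theorem exists_shift_basis_of_inv (z : localPi E c 1 J₁ v)
    (h : ∃ b : ℤ → SchwartzBruhat (Fin N → v.adicCompletion F), b 0 = unitVec F (Fin N) v ∧ LinearIndependent ℂ b ∧
      (∀ j : ℤ, 𝓢.omegaLoc v (localCenter E c N J J₁ hJ₁ v z⁻¹) (b j) = b (j + 1)) ∧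
      (∀ u : SchwartzBruhat (Fin N → v.adicCompletion F),
        (∀ κ ∈ localInt E c N J v, 𝓢.omegaLoc v κ u = u) → u ∈ Submodule.span ℂ (Set.range b))) :
    ∃ b : ℤ → SchwartzBruhat (Fin N → v.adicCompletion F), b 0 = unitVec F (Fin N) v ∧ LinearIndependent ℂ b ∧
      (∀ j : ℤ, 𝓢.omegaLoc v (localCenter E c N J J₁ hJ₁ v z) (b j) = b (j + 1)) ∧
      (∀ u : SchwartzBruhat (Fin N → v.adicCompletion F),
        (∀ κ ∈ localInt E c N J v, 𝓢.omegaLoc v κ u = u) → u ∈ Submodule.span ℂ (Set.range b)) := by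
  obtain ⟨b, hb0, hbli, hbT, hbspan⟩ := h
  have hneg : Function.Injective (fun j : ℤ => -j) := neg_injective
  refine ⟨fun j => b (-j), by simp only [neg_zero, hb0], hbli.comp _ hneg, fun j => ?_, fun u hu => ?_⟩
  · -- `ω(z) (b (-j)) = b (-(j+1))` from `ω(z⁻¹) (b (-(j+1))) = b (-j)`
    have h1 := hbT (-(j + 1))
    rw [show -(j + 1) + 1 = -j by ring] at h1
    -- apply `ω(z)` to both sides: `ω(z) (ω(z⁻¹) x) = x`
    have h3 : localCenter E c N J J₁ hJ₁ v z * localCenter E c N J J₁ hJ₁ v z⁻¹ = 1 := by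
      rw [← map_mul (localCenter E c N J J₁ hJ₁ v), mul_inv_cancel, map_one]
    have h2 : 𝓢.omegaLoc v (localCenter E c N J J₁ hJ₁ v z)
        (𝓢.omegaLoc v (localCenter E c N J J₁ hJ₁ v z⁻¹) (b (-(j + 1)))) = b (-(j + 1)) := by
      rw [← Module.End.mul_apply, ← map_mul (𝓢.omegaLoc v), h3, map_one, Module.End.one_apply]
    rw [h1] at h2
    exact h2
  · rw [show (Set.range fun j : ℤ => b (-j)) = Set.range b from ?_]
    · exact hbspan u hu
    ext x
    constructor
    · rintro ⟨j, rfl⟩; exact ⟨-j, rfl⟩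
    · rintro ⟨j, rfl⟩; exact ⟨-j, by simp only [neg_neg]⟩

omit [Algebra.IsQuadraticExtension F E] in
/-- a generator of `U(J₁)(F_v)` modulo `U(J₁)(𝒪_v)` stays a generator after inversion. [cite: GelbartRogawski1991, §3.2] -/
theorem forall_exists_eq_mul_zpow_inv {z₀ : localPi E c 1 J₁ v}
    (hz₀ : ∀ h : localPi E c 1 J₁ v, ∃ (k₀ : localPi E c 1 J₁ v) (m : ℤ), k₀ ∈ localInt E c 1 J₁ v ∧ h = k₀ * z₀ ^ m)
    (h : localPi E c 1 J₁ v) : ∃ (k₀ : localPi E c 1 J₁ v) (m : ℤ), k₀ ∈ localInt E c 1 J₁ v ∧ h = k₀ * z₀⁻¹ ^ m := by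
  obtain ⟨k₀, m, hk₀, rfl⟩ := hz₀ h
  exact ⟨k₀, -m, hk₀, by rw [inv_zpow', neg_neg]⟩

/-! ## §3 Bookkeeping at almost every place -/

omit [Algebra.IsQuadraticExtension F E] in
/-- `2` is a `v`-adic unit for almost all `v`. [cite: CasselsFrohlichANT1967, Ch. II §16] -/
theorem eventually_valued_two_eq_one :
    ∀ᶠ v : HeightOneSpectrum (𝓞 F) in cofinite, Valued.v (2 : v.adicCompletion F) = 1 :=
  (UnitaryGroup.eventually_valued_algebraMap_eq_one (E := F) (two_ne_zero : (2 : F) ≠ 0)).mono fun v hv => by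
    rwa [map_ofNat] at hv

omit [Algebra.IsQuadraticExtension F E] in
/-- the inverse of the local Gram matrix is `v`-integral for almost all `v` (`T ∈ GL_N(F)`).
[cite: CasselsFrohlichANT1967, Ch. II §16] -/
theorem eventually_forall_localGram_inv_mem (hTd : IsUnit T.det) :
    ∀ᶠ v : HeightOneSpectrum (𝓞 F) in cofinite, ∀ i j,
      (localGram F N T v)⁻¹ i j ∈ primePowBall (v.adicCompletion F) 0 := by
  refine (eventually_forall_entry_mem F T⁻¹).mono fun v hv i j => ?_
  have hmap : (localGram F N T v)⁻¹ = (T⁻¹).map (algebraMap F (v.adicCompletion F)) := by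
    refine Matrix.inv_eq_left_inv ?_
    rw [localGram, ← Matrix.map_mul, Matrix.nonsing_inv_mul T hTd,
      Matrix.map_one _ (map_zero _) (map_one _)]
  rw [hmap, Matrix.map_apply]
  exact (mem_primePowBall_zero_iff _).2 (hv i j)

omit [NumberField F] [Algebra.IsQuadraticExtension F E] in
/-- the `(0,0)` entry of the inverse of an invertible `1 × 1` matrix is the inverse of the entry. [folklore] -/
private theorem coe_inv_apply_zero_zero {K : Type*} [Field K] (g : GL (Fin 1) K) :
    ((g⁻¹ : GL (Fin 1) K) : Matrix (Fin 1) (Fin 1) K) 0 0 = ((g : Matrix (Fin 1) (Fin 1) K) 0 0)⁻¹ := by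
  have h : ((g : Matrix (Fin 1) (Fin 1) K) 0 0) * (((g⁻¹ : GL (Fin 1) K) : Matrix (Fin 1) (Fin 1) K) 0 0) = 1 := by
    have := congrArg (fun M : Matrix (Fin 1) (Fin 1) K => M 0 0)
      (show (g : Matrix (Fin 1) (Fin 1) K) * ((g⁻¹ : GL (Fin 1) K) : Matrix (Fin 1) (Fin 1) K) = 1 by
        rw [← Units.val_mul, mul_inv_cancel, Units.val_one])
    simpa only [Matrix.mul_apply, Fin.sum_univ_one, Matrix.one_apply_eq] using this
  exact eq_inv_of_mul_eq_one_right h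

omit [Algebra.IsQuadraticExtension F E] in
/-- the `w`-coordinate of `z₀⁻¹` is the inverse of that of `z₀` (entries of `1 × 1` matrices), hence has the inverse
valuation. [cite: GelbartRogawski1991, §3.2] -/
theorem valued_coe_inv_apply (z₀ : localPi E c 1 J₁ v) (w : PlacesOver E v) :
    Valued.v ((((z₀⁻¹ : localPi E c 1 J₁ v) : LocalGLPi E 1 v) w : Matrix (Fin 1) (Fin 1) (w.1.adicCompletion E)) 0 0) =
      (Valued.v ((((z₀ : localPi E c 1 J₁ v) : LocalGLPi E 1 v) w : Matrix (Fin 1) (Fin 1) (w.1.adicCompletion E)) 0 0))⁻¹ := by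
  rw [Subgroup.coe_inv, Pi.inv_apply, coe_inv_apply_zero_zero, map_inv₀]

include hTd in
/-- **(SPH) at a place for EVERY generator `z₀`, from split-place Darboux data at `w ∣ v`** (both orientations): given
`γ ∈ Sp(𝕎_v)` preserving the box, a coordinate `t : U(J₁)(F_v) → F_v` with `|t z|_w = |z_w|` and
`ι_v(z · 1_N) = γ⁻¹ m(t z · 1) γ` for all `z`, the surjectivity `γ⁻¹ m(GL_N(𝒪_v)) γ ⊆ ι_v(U(J)(𝒪_v))`, and the
dichotomy `|z₀,w| = q^{∓1}` for generators — then every generator `z₀` of `U(J₁)(F_v)/U(J₁)(𝒪_v)` carries spherical data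
(`|z₀,w| = q_v⁻¹`: the core at `z₀`; `|z₀,w| = q_v`: the core at `z₀⁻¹` and the flip).
[cite: GelbartRogawski1991, §3.1 (3.1.3) p. 456, §3.2; MoeglinVignerasWaldspurger1987, Chap. 2 III.1] -/
theorem forall_exists_shift_basis_of_darboux [NeZero N]
    (hcond : (adeleAddCharAt F v).HasConductorExp 0)
    (h2 : (⅟(2 : v.adicCompletion F) : v.adicCompletion F) ∈ v.adicCompletionIntegers F)
    (hTi : ∀ i j, localGram F N T v i j ∈ primePowBall (v.adicCompletion F) 0)
    (hTi' : ∀ i j, (localGram F N T v)⁻¹ i j ∈ primePowBall (v.adicCompletion F) 0)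
    (hunr : ∀ κ ∈ localInt E c N J v, 𝓢.omegaLoc v κ (unitVec F (Fin N) v) = unitVec F (Fin N) v)
    (w : PlacesOver E v) (γ : LocalSp F N T v)
    (hγ : ∀ p ∈ (piPrimePowBall (v.adicCompletion F) (Fin N) 0) ×ˢ (piPrimePowBall (v.adicCompletion F) (Fin N) 0),
      (γ : ((Fin N → v.adicCompletion F) × (Fin N → v.adicCompletion F)) ≃ₗ[v.adicCompletion F]
        ((Fin N → v.adicCompletion F) × (Fin N → v.adicCompletion F))) p ∈
        (piPrimePowBall (v.adicCompletion F) (Fin N) 0) ×ˢ (piPrimePowBall (v.adicCompletion F) (Fin N) 0))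
    (t : localPi E c 1 J₁ v → v.adicCompletion F)
    (ht : ∀ z : localPi E c 1 J₁ v, Valued.v (t z) =
      Valued.v ((((z : localPi E c 1 J₁ v) : LocalGLPi E 1 v) w : Matrix (Fin 1) (Fin 1) (w.1.adicCompletion E)) 0 0))
    (hcenter : ∀ (z : localPi E c 1 J₁ v) (a₀ : GL (Fin N) (v.adicCompletion F)),
      (a₀ : Matrix (Fin N) (Fin N) (v.adicCompletion F)) = t z • 1 →
      iota F E c N hcδ hδ hd T hT hJ v (localCenter E c N J J₁ hJ₁ v z) =
        γ⁻¹ * SymplecticMatrix.transportSp (localGram F N T v) (isUnit_det_localGram F N T hTd v)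
          (SymplecticMatrix.levi a₀) * γ)
    (hcompact : ∀ a : GL (Fin N) 𝒪[v.adicCompletion F], ∃ κ ∈ localInt E c N J v,
      iota F E c N hcδ hδ hd T hT hJ v κ =
        γ⁻¹ * SymplecticMatrix.transportSp (localGram F N T v) (isUnit_det_localGram F N T hTd v)
          (SymplecticMatrix.levi (Matrix.GeneralLinearGroup.map (𝒪[v.adicCompletion F]).subtype a)) * γ)
    (hgen : ∀ z₀ : localPi E c 1 J₁ v,
      (∀ h : localPi E c 1 J₁ v, ∃ (k₀ : localPi E c 1 J₁ v) (m : ℤ), k₀ ∈ localInt E c 1 J₁ v ∧ h = k₀ * z₀ ^ m) →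
      Valued.v ((((z₀ : localPi E c 1 J₁ v) : LocalGLPi E 1 v) w : Matrix (Fin 1) (Fin 1) (w.1.adicCompletion E)) 0 0) =
          WithZero.exp (-1) ∨
        Valued.v ((((z₀ : localPi E c 1 J₁ v) : LocalGLPi E 1 v) w : Matrix (Fin 1) (Fin 1) (w.1.adicCompletion E)) 0 0) =
          WithZero.exp 1)
    (z₀ : localPi E c 1 J₁ v)
    (hz₀ : ∀ h : localPi E c 1 J₁ v, ∃ (k₀ : localPi E c 1 J₁ v) (m : ℤ), k₀ ∈ localInt E c 1 J₁ v ∧ h = k₀ * z₀ ^ m) :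
    ∃ b : ℤ → SchwartzBruhat (Fin N → v.adicCompletion F), b 0 = unitVec F (Fin N) v ∧ LinearIndependent ℂ b ∧
      (∀ j : ℤ, 𝓢.omegaLoc v (localCenter E c N J J₁ hJ₁ v z₀) (b j) = b (j + 1)) ∧
      (∀ u : SchwartzBruhat (Fin N → v.adicCompletion F),
        (∀ κ ∈ localInt E c N J v, 𝓢.omegaLoc v κ u = u) → u ∈ Submodule.span ℂ (Set.range b)) := by
  -- the core at a `z` whose coordinate has valuation `exp (-1)`
  have core : ∀ z : localPi E c 1 J₁ v, Valued.v (t z) = WithZero.exp (-1) →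
      ∃ b : ℤ → SchwartzBruhat (Fin N → v.adicCompletion F), b 0 = unitVec F (Fin N) v ∧ LinearIndependent ℂ b ∧
        (∀ j : ℤ, 𝓢.omegaLoc v (localCenter E c N J J₁ hJ₁ v z) (b j) = b (j + 1)) ∧
        (∀ u : SchwartzBruhat (Fin N → v.adicCompletion F),
          (∀ κ ∈ localInt E c N J v, 𝓢.omegaLoc v κ u = u) → u ∈ Submodule.span ℂ (Set.range b)) := by
    intro z hz
    have hnorm : normAbs (v.adicCompletion F) (t z) = (residueFieldCard (v.adicCompletion F) : ℝ≥0)⁻¹ := by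
      rw [normAbs_eq_inv_zpow_of_valued_eq v hz, neg_neg, zpow_one]
    have ht0 : t z ≠ 0 := fun h0 => by
      rw [h0, map_zero] at hnorm; exact (inv_ne_zero (Nat.cast_ne_zero.2 (residueFieldCard_ne_zero _))) hnorm.symm
    -- the scalar unit `a₀ = t z · 1`
    let a₀ : GL (Fin N) (v.adicCompletion F) :=
      Units.map (algebraMap (v.adicCompletion F) (Matrix (Fin N) (Fin N) (v.adicCompletion F))).toMonoidHom
        (Units.mk0 (t z) ht0)
    have ha₀ : (a₀ : Matrix (Fin N) (Fin N) (v.adicCompletion F)) = t z • 1 := by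
      change algebraMap (v.adicCompletion F) (Matrix (Fin N) (Fin N) (v.adicCompletion F)) (t z) = _
      exact Algebra.algebraMap_eq_smul_one (t z)
    exact 𝓢.exists_shift_basis_of_iota_localCenter_eq J₁ hJ₁ hTd v hcond h2 hTi hTi' hunr γ hγ hnorm ha₀ z
      (hcenter z a₀ ha₀) hcompact
  rcases hgen z₀ hz₀ with hneg | hpos
  · exact core z₀ ((ht z₀).trans hneg)
  · -- `|z₀,w| = q`: run the core at `z₀⁻¹` and flip
    refine 𝓢.exists_shift_basis_of_inv J₁ hJ₁ v z₀ (core z₀⁻¹ ?_)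
    rw [ht z₀⁻¹, valued_coe_inv_apply J₁ v z₀ w, hpos, ← WithZero.exp_neg]

/-! ## §4 The assembly at almost every place, from split-place Darboux data -/

include hTd in
/-- **(SPH) at almost every place of `F`, at every split `w ∣ v`, for every generator `z₀`** — the hypothesis `hsph` of
`Liu2021/Def411WeilCarriersSurvivalSplit.exists_finset_mk_unitVec_ne_zero_of_sph` — from split-place DARBOUX DATA: for every
place `v` and split `w ∣ v` an element `γ_{v,w} ∈ Sp(𝕎_v)` and a coordinate `t_{v,w} : U(J₁)(F_v) → F_v` such that
(eventually in `v`) `γ_{v,w}` preserves `𝒪_vᴺ × 𝒪_vᴺ`, `|t_{v,w}(z)| = |z_w|`, `ι_v(z · 1_N) = γ⁻¹ m(t(z) · 1) γ`,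
`γ⁻¹ m(GL_N(𝒪_v)) γ ⊆ ι_v(U(J)(𝒪_v))`, and generators have `|z₀,w| = q_v^{∓1}` (all supplied by
`GelbartRogawski1991/LocalUnitarySplitPlaceDarboux`).  The remaining unramifiedness conditions (`ψ_v`, `2`, `T^{±1}`,
`𝓢.unramified`) are discharged here. [cite: GelbartRogawski1991, §3.1 (3.1.3) p. 456, §3.2; MoeglinVignerasWaldspurger1987, Chap. 2 II.10, III.1] -/
theorem eventually_forall_exists_shift_basis_of_darboux [NeZero N]
    (γ : ∀ (v : HeightOneSpectrum (𝓞 F)) (w : PlacesOver E v), c • w.1 ≠ w.1 → LocalSp F N T v)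
    (t : ∀ (v : HeightOneSpectrum (𝓞 F)), PlacesOver E v → localPi E c 1 J₁ v → v.adicCompletion F)
    (hγ : ∀ᶠ v : HeightOneSpectrum (𝓞 F) in cofinite, ∀ (w : PlacesOver E v) (hw : c • w.1 ≠ w.1),
      ∀ p ∈ (piPrimePowBall (v.adicCompletion F) (Fin N) 0) ×ˢ (piPrimePowBall (v.adicCompletion F) (Fin N) 0),
        (γ v w hw : ((Fin N → v.adicCompletion F) × (Fin N → v.adicCompletion F)) ≃ₗ[v.adicCompletion F]
          ((Fin N → v.adicCompletion F) × (Fin N → v.adicCompletion F))) p ∈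
          (piPrimePowBall (v.adicCompletion F) (Fin N) 0) ×ˢ (piPrimePowBall (v.adicCompletion F) (Fin N) 0))
    (ht : ∀ (v : HeightOneSpectrum (𝓞 F)) (w : PlacesOver E v), c • w.1 ≠ w.1 → ∀ z : localPi E c 1 J₁ v,
      Valued.v (t v w z) =
        Valued.v ((((z : localPi E c 1 J₁ v) : LocalGLPi E 1 v) w : Matrix (Fin 1) (Fin 1) (w.1.adicCompletion E)) 0 0))
    (hcenter : ∀ (v : HeightOneSpectrum (𝓞 F)) (w : PlacesOver E v) (hw : c • w.1 ≠ w.1) (z : localPi E c 1 J₁ v)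
      (a₀ : GL (Fin N) (v.adicCompletion F)), (a₀ : Matrix (Fin N) (Fin N) (v.adicCompletion F)) = t v w z • 1 →
      iota F E c N hcδ hδ hd T hT hJ v (localCenter E c N J J₁ hJ₁ v z) =
        (γ v w hw)⁻¹ * SymplecticMatrix.transportSp (localGram F N T v) (isUnit_det_localGram F N T hTd v)
          (SymplecticMatrix.levi a₀) * γ v w hw)
    (hcompact : ∀ᶠ v : HeightOneSpectrum (𝓞 F) in cofinite, ∀ (w : PlacesOver E v) (hw : c • w.1 ≠ w.1),
      ∀ a : GL (Fin N) 𝒪[v.adicCompletion F], ∃ κ ∈ localInt E c N J v,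
        iota F E c N hcδ hδ hd T hT hJ v κ =
          (γ v w hw)⁻¹ * SymplecticMatrix.transportSp (localGram F N T v) (isUnit_det_localGram F N T hTd v)
            (SymplecticMatrix.levi (Matrix.GeneralLinearGroup.map (𝒪[v.adicCompletion F]).subtype a)) * γ v w hw)
    (hgen : ∀ᶠ v : HeightOneSpectrum (𝓞 F) in cofinite, ∀ w : PlacesOver E v, c • w.1 ≠ w.1 →
      ∀ z₀ : localPi E c 1 J₁ v,
        (∀ h : localPi E c 1 J₁ v, ∃ (k₀ : localPi E c 1 J₁ v) (m : ℤ), k₀ ∈ localInt E c 1 J₁ v ∧ h = k₀ * z₀ ^ m) →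
        Valued.v ((((z₀ : localPi E c 1 J₁ v) : LocalGLPi E 1 v) w : Matrix (Fin 1) (Fin 1) (w.1.adicCompletion E)) 0 0) =
            WithZero.exp (-1) ∨
          Valued.v ((((z₀ : localPi E c 1 J₁ v) : LocalGLPi E 1 v) w : Matrix (Fin 1) (Fin 1) (w.1.adicCompletion E)) 0 0) =
            WithZero.exp 1) :
    ∀ᶠ v : HeightOneSpectrum (𝓞 F) in cofinite, ∀ w : PlacesOver E v, c • w.1 ≠ w.1 →
      ∀ z₀ : localPi E c 1 J₁ v,
        (∀ h : localPi E c 1 J₁ v, ∃ (k₀ : localPi E c 1 J₁ v) (m : ℤ), k₀ ∈ localInt E c 1 J₁ v ∧ h = k₀ * z₀ ^ m) →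
        ∃ b : ℤ → SchwartzBruhat (Fin N → v.adicCompletion F), b 0 = unitVec F (Fin N) v ∧ LinearIndependent ℂ b ∧
          (∀ j : ℤ, 𝓢.omegaLoc v (localCenter E c N J J₁ hJ₁ v z₀) (b j) = b (j + 1)) ∧
          (∀ u : SchwartzBruhat (Fin N → v.adicCompletion F),
            (∀ κ ∈ localInt E c N J v, 𝓢.omegaLoc v κ u = u) → u ∈ Submodule.span ℂ (Set.range b)) := by
  filter_upwards [𝓢.unramified, eventually_hasConductorExp_zero_adicComponent_adeleAddChar (K := F),
    eventually_invOf_two_mem F, eventually_forall_entry_mem F T, eventually_forall_localGram_inv_mem hTd, hγ,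
    hcompact, hgen] with v hunr hcond h2 hTi hTi' hγv hcv hgv
  intro w hw z₀ hz₀
  exact 𝓢.forall_exists_shift_basis_of_darboux J₁ hJ₁ hTd v hcond h2
    (fun i j => (mem_primePowBall_zero_iff _).2 (hTi i j)) hTi' (fun κ hκ => hunr κ hκ) w (γ v w hw) (hγv w hw)
    (t v w) (ht v w hw) (hcenter v w hw) (hcv w hw) (hgv w hw) z₀ hz₀

end Literature.NumberTheory.GelbartRogawski1991.UnitaryDualPair.LocalSplitting.FinLocalSplittings
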